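import Literature.MathematicalPhysics.QuantumFieldTheory.SUNBakryEmeryPolyApprox
import Mathlib.MeasureTheory.Measure.Haar.Unique
import Mathlib.Topology.UniformSpace.HeineCantor
import HarnessLib

/-!
# Weierstrass approximation with derivatives on `SU(N)`: polynomials are `C¹`-dense

For every `C¹` function `v : M_N(ℂ) → ℝ` vanishing outside a ball and every `ε > 0` there is a polynomial function
`P ∈ 𝒫_n` (real polynomial in the coordinates `Re Q_{ab}`, `Im Q_{ab}`) with `|P − v| ≤ ε` and
`|D_α P − D_α v| ≤ ε` on `SU(N)` for all frame directions `α` (`exists_poly_approx_C1`).  Proof à la Landau–Lang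
(S. Lang, *Math Talks for Undergraduates* (1999), «Dirac sequences», pp. 36–38): convolve `v` with the normalised Landau
kernel `(R² − ‖z‖²)^k` — the result is a polynomial (`integral_mul_landau_mem_polySpace`), its values and derivatives
are convolutions of `v` and `Dv` over a ball (`integral_mul_kernel_eq_setIntegral`, `matD_integral_mul_kernel`), and
the Dirac estimate (`norm_setIntegral_smul_sub_le`) with the geometric tail bound (`landau_tail_div_le`) gives uniform
convergence, uniformly on the compact group.  Derivatives `Dv(y)[u]` are reduced to the finitely many scalar functions
`y ↦ Dv(y)[E_κ]` over the real basis `E_κ` of `M_N(ℂ)` (`fderiv_apply_eq_sum_coordFn`).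
This is the approximation step that extends the Bakry–Émery log-Sobolev inequality from polynomials
(`logSobolev_poly`) to all smooth functions (sequel).  Theorems only; no definition.

Reference: S. Lang, *Math Talks for Undergraduates*, Springer (1999), pp. 36–38 [Lang1999MathTalks].
-/

noncomputable section

open scoped Matrix ComplexConjugate BigOperators

namespace Literature.MathematicalPhysics.QuantumFieldTheory

namespace SUNBakryEmery

open scoped Matrix.Norms.Frobenius ContDiff Topology
open Matrix Complex Finset MeasureTheory Filter Set Metric

variable {N : ℕ}

/-! ### The real basis of `M_N(ℂ)` dual to the coordinates -/

/-- Expansion of a matrix in the real basis `E_{ab}`, `i E_{ab}` with the coordinates `Re u_{ab}`, `Im u_{ab}`: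
`u = ∑_κ coordinate_κ(u) • E_κ`. [cite: arXiv220412737, §2 (2.3) (p. 10)] -/
theorem sum_coordFn_smul_basis (u : Matrix (Fin N) (Fin N) ℂ) :
    ∑ κ : CoordIdx N, coordFn κ u • Matrix.single κ.1 κ.2.1 (if κ.2.2 then (1 : ℂ) else Complex.I) = u := by
  ext a b
  simp only [CoordIdx, Matrix.sum_apply, Fintype.sum_prod_type, Fintype.sum_bool, Matrix.smul_apply,
    coordFn_true, coordFn_false, if_true, Bool.false_eq_true, if_false]
  rw [Finset.sum_eq_single a, Finset.sum_eq_single b]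
  · simp only [Matrix.single_apply_same]
    apply Complex.ext <;> simp
  · intro b' _ hb'
    simp [hb']
  · intro h; exact absurd (Finset.mem_univ b) h
  · intro a' _ ha'
    refine Finset.sum_eq_zero fun b' _ => ?_
    simp [ha']
  · intro h; exact absurd (Finset.mem_univ a) h

/-- A real-linear functional of `u` in the coordinates: `L(u) = ∑_κ coordinate_κ(u) · L(E_κ)`; used for `L = Dv(y)`.
[cite: Lang1999MathTalks, Dirac sequences p. 36–37 (proof device)] -/
theorem clm_apply_eq_sum_coordFn (L : Matrix (Fin N) (Fin N) ℂ →L[ℝ] ℝ) (u : Matrix (Fin N) (Fin N) ℂ) :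
    L u = ∑ κ : CoordIdx N, coordFn κ u * L (Matrix.single κ.1 κ.2.1 (if κ.2.2 then (1 : ℂ) else Complex.I)) := by
  conv_lhs => rw [← sum_coordFn_smul_basis u]
  rw [map_sum]
  exact sum_congr rfl fun κ _ => by rw [map_smul, smul_eq_mul]

/-- Uniform bound on the coordinates of `g Y_α`, `g ∈ SU(N)`, `α` a frame index (compactness).
[cite: Lang1999MathTalks, Dirac sequences p. 36–37 (proof device)] -/
theorem exists_bound_coordFn_mul_frame :
    ∃ C : ℝ, 0 ≤ C ∧ ∀ (g : SUN N) (α : FrameIdx N),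
      ∑ κ : CoordIdx N, |coordFn κ ((g : Matrix (Fin N) (Fin N) ℂ) * frame α)| ≤ C := by
  have hcont : Continuous fun g : SUN N =>
      ∑ α : FrameIdx N, ∑ κ : CoordIdx N, |coordFn κ ((g : Matrix (Fin N) (Fin N) ℂ) * frame α)| := by
    refine continuous_finsetSum _ fun α _ => continuous_finsetSum _ fun κ _ => ?_
    exact ((continuous_of_contDiff (contDiff_coordFn κ)).comp (continuous_subtype_val.mul continuous_const)).abs
  obtain ⟨C, hC⟩ := isCompact_univ.exists_bound_of_continuousOn hcont.continuousOn
  refine ⟨max C 0, le_max_right _ _, fun g α => ?_⟩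
  have h := hC g (mem_univ _)
  rw [Real.norm_eq_abs] at h
  have h2 : ∑ κ : CoordIdx N, |coordFn κ ((g : Matrix (Fin N) (Fin N) ℂ) * frame α)| ≤
      ∑ α' : FrameIdx N, ∑ κ : CoordIdx N, |coordFn κ ((g : Matrix (Fin N) (Fin N) ℂ) * frame α')| :=
    Finset.single_le_sum (f := fun α' => ∑ κ : CoordIdx N, |coordFn κ ((g : Matrix (Fin N) (Fin N) ℂ) * frame α')|)
      (fun α' _ => sum_nonneg fun κ _ => abs_nonneg _) (mem_univ α)
  exact (h2.trans ((le_abs_self _).trans h)).trans (le_max_left _ _)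

/-- The Dirac estimate rewritten for a scalar kernel with `∫_B K = 1`:
`|∫_B K(z) w(x − z) dμ − w(x)| ≤ a + 2MT`. [cite: Lang1999MathTalks, Dirac sequences, approximation theorem p. 37] -/
theorem abs_setIntegral_mul_sub_le {E : Type*} [NormedAddCommGroup E] [MeasurableSpace E] [OpensMeasurableSpace E]
    {μ : Measure E} [IsFiniteMeasureOnCompacts μ] {B : Set E} (hBc : IsCompact B) (hBm : MeasurableSet B)
    {K : E → ℝ} (hK : ContinuousOn K B) (hK0 : ∀ z ∈ B, 0 ≤ K z) (hK1 : ∫ z in B, K z ∂μ = 1)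
    {w : E → ℝ} (hw : Continuous w) (x : E) {η a M T : ℝ} (ha0 : 0 ≤ a) (hM0 : 0 ≤ M)
    (ha : ∀ z, ‖z‖ ≤ η → |w (x - z) - w x| ≤ a) (hM : ∀ y, |w y| ≤ M)
    (hT : ∫ z in B \ closedBall 0 η, K z ∂μ ≤ T) :
    |∫ z in B, K z * w (x - z) ∂μ - w x| ≤ a + 2 * M * T := by
  have hKi : IntegrableOn K B μ := hK.integrableOn_compact hBc
  have h1 : IntegrableOn (fun z => K z * w (x - z)) B μ :=
    (hK.mul (hw.comp (continuous_const.sub continuous_id)).continuousOn).integrableOn_compact hBc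
  have e : ∫ z in B, K z * w (x - z) ∂μ - w x = ∫ z in B, K z • (w (x - z) - w x) ∂μ := by
    have h3 : ∫ z in B, K z • (w (x - z) - w x) ∂μ =
        ∫ z in B, K z * w (x - z) ∂μ - ∫ z in B, K z * w x ∂μ := by
      rw [← integral_sub h1 (hKi.mul_const _)]
      refine integral_congr_ae (ae_of_all _ fun z => ?_)
      simp only [smul_eq_mul]
      ring
    rw [h3, integral_mul_const, hK1, one_mul]
  rw [e, ← Real.norm_eq_abs]
  exact norm_setIntegral_smul_sub_le hBc hBm hK hK0 hK1 hw x ha0 hM0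
    (fun z hz => by rw [Real.norm_eq_abs]; exact ha z hz) (fun y => by rw [Real.norm_eq_abs]; exact hM y) hT

/-! ### Two budget inequalities (bookkeeping of the `ε/3` argument) -/

/-- Budget for the values: `ε/3 + 2M₀(C_μ t) ≤ ε` once `t < (ε/3)/((C_μ+1)(2M₀+2CM₁+1))`.
[cite: Lang1999MathTalks, Dirac sequences p. 37 (proof device)] -/
theorem landau_budget_value {ε M₀ M₁ C Cμ t : ℝ} (hε : 0 < ε) (hM₀ : 0 ≤ M₀) (hM₁ : 0 ≤ M₁) (hC : 0 ≤ C)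
    (hCμ : 0 ≤ Cμ) (ht : 0 ≤ t) (hk : t < ε / 3 / ((Cμ + 1) * (2 * M₀ + 2 * C * M₁ + 1))) :
    ε / 3 + 2 * M₀ * (Cμ * t) ≤ ε := by
  have hL : 0 < (Cμ + 1) * (2 * M₀ + 2 * C * M₁ + 1) := by positivity
  have h1 : t * ((Cμ + 1) * (2 * M₀ + 2 * C * M₁ + 1)) < ε / 3 := by rwa [lt_div_iff₀ hL] at hk
  have h2 : 2 * M₀ * Cμ ≤ (Cμ + 1) * (2 * M₀ + 2 * C * M₁ + 1) := by
    nlinarith [mul_nonneg hM₀ hCμ, mul_nonneg hC hM₁, mul_nonneg hCμ (mul_nonneg hC hM₁)]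
  have h3 : 2 * M₀ * (Cμ * t) ≤ t * ((Cμ + 1) * (2 * M₀ + 2 * C * M₁ + 1)) := by
    have := mul_le_mul_of_nonneg_left h2 ht
    nlinarith
  linarith

/-- Budget for the derivatives: `C(ε/(3(C+1)) + 2M₁(C_μ t)) ≤ ε` once `t < (ε/3)/((C_μ+1)(2M₀+2CM₁+1))`.
[cite: Lang1999MathTalks, Dirac sequences p. 37 (proof device)] -/
theorem landau_budget_deriv {ε M₀ M₁ C Cμ t : ℝ} (hε : 0 < ε) (hM₀ : 0 ≤ M₀) (hM₁ : 0 ≤ M₁) (hC : 0 ≤ C)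
    (hCμ : 0 ≤ Cμ) (ht : 0 ≤ t) (hk : t < ε / 3 / ((Cμ + 1) * (2 * M₀ + 2 * C * M₁ + 1))) :
    C * (ε / (3 * (C + 1)) + 2 * M₁ * (Cμ * t)) ≤ ε := by
  have hL : 0 < (Cμ + 1) * (2 * M₀ + 2 * C * M₁ + 1) := by positivity
  have h1 : t * ((Cμ + 1) * (2 * M₀ + 2 * C * M₁ + 1)) < ε / 3 := by rwa [lt_div_iff₀ hL] at hk
  have h2 : C * (ε / (3 * (C + 1))) ≤ ε / 3 := by
    rw [mul_div_assoc', div_le_div_iff₀ (by positivity) (by positivity)]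
    nlinarith
  have h3 : C * (2 * M₁ * (Cμ * t)) ≤ ε / 3 := by
    have h4 : 2 * C * M₁ * Cμ ≤ (Cμ + 1) * (2 * M₀ + 2 * C * M₁ + 1) := by
      nlinarith [mul_nonneg hM₀ hCμ, mul_nonneg hC hM₁, mul_nonneg hCμ (mul_nonneg hC hM₁), mul_nonneg hCμ hM₀]
    have h5 : C * (2 * M₁ * (Cμ * t)) ≤ t * ((Cμ + 1) * (2 * M₀ + 2 * C * M₁ + 1)) := by
      have := mul_le_mul_of_nonneg_left h4 ht
      nlinarith
    linarith
  have h6 : C * (ε / (3 * (C + 1)) + 2 * M₁ * (Cμ * t)) = C * (ε / (3 * (C + 1))) + C * (2 * M₁ * (Cμ * t)) := by ring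
  linarith

/-! ### ★ Polynomials are `C¹`-dense on `SU(N)` -/

/-- ★ **Weierstrass approximation with derivatives on `SU(N)`** (Landau–Lang): for a `C¹` function `v` on `M_N(ℂ)`
vanishing outside the ball of radius `r₂` and `ε > 0`, there is a polynomial `P ∈ 𝒫_n` with `|P − v| ≤ ε` and
`|D_α P − D_α v| ≤ ε` on `SU(N)` for every frame direction `α`. [cite: Lang1999MathTalks, Dirac sequences and the Weierstrass approximation theorem pp. 36–38] -/
theorem exists_poly_approx_C1_measure [MeasurableSpace (Matrix (Fin N) (Fin N) ℂ)] [BorelSpace (Matrix (Fin N) (Fin N) ℂ)]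
    (μ : Measure (Matrix (Fin N) (Fin N) ℂ)) [IsFiniteMeasureOnCompacts μ] [μ.IsAddLeftInvariant] [μ.IsNegInvariant]
    [μ.IsOpenPosMeasure]
    {v : Matrix (Fin N) (Fin N) ℂ → ℝ} (hv : ContDiff ℝ 1 v) {r₂ : ℝ} (hr₂ : 0 < r₂)
    (hvr : ∀ y, r₂ < ‖y‖ → v y = 0) {ε : ℝ} (hε : 0 < ε) :
    ∃ n : ℕ, ∃ P ∈ polySpace N n,
      (∀ x : Matrix (Fin N) (Fin N) ℂ, x ∈ Matrix.specialUnitaryGroup (Fin N) ℂ → |P x - v x| ≤ ε) ∧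
      ∀ x : Matrix (Fin N) (Fin N) ℂ, x ∈ Matrix.specialUnitaryGroup (Fin N) ℂ →
        ∀ α : FrameIdx N, |matD (frame α) P x - matD (frame α) v x| ≤ ε := by
  classical
  -- geometry of `SU(N)`: a bound on `‖g‖` (compactness)
  obtain ⟨C₀, hC₀⟩ := isCompact_univ.exists_bound_of_continuousOn
    ((continuous_subtype_val (p := fun Q : Matrix (Fin N) (Fin N) ℂ =>
      Q ∈ Matrix.specialUnitaryGroup (Fin N) ℂ)).norm.continuousOn)
  obtain ⟨C, hC0, hC⟩ := exists_bound_coordFn_mul_frame (N := N)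
  -- the Frobenius-norm topology is (definitionally) the product topology: norm-topology copies of the instances
  haveI hO' : @OpensMeasurableSpace (Matrix (Fin N) (Fin N) ℂ) (matTop N) _ :=
    ‹BorelSpace (Matrix (Fin N) (Fin N) ℂ)›.opensMeasurable
  haveI hF' : @IsFiniteMeasureOnCompacts (Matrix (Fin N) (Fin N) ℂ) _ (matTop N) μ := ‹IsFiniteMeasureOnCompacts μ›
  haveI hP' : @Measure.IsOpenPosMeasure (Matrix (Fin N) (Fin N) ℂ) (matTop N) _ μ := ‹μ.IsOpenPosMeasure›
  -- basic objects
  have hvc : Continuous v := hv.continuous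
  have hvs : HasCompactSupport v :=
    HasCompactSupport.intro (isCompact_closedBall (0 : Matrix (Fin N) (Fin N) ℂ) r₂) fun y hy =>
      hvr y (by rwa [mem_closedBall_zero_iff, not_le] at hy)
  -- the scalar partial derivatives `d κ y = Dv(y)[E_κ]`
  set bM : CoordIdx N → Matrix (Fin N) (Fin N) ℂ := fun κ => Matrix.single κ.1 κ.2.1 (if κ.2.2 then (1 : ℂ) else Complex.I)
    with hbM
  set d : CoordIdx N → Matrix (Fin N) (Fin N) ℂ → ℝ := fun κ y => fderiv ℝ v y (bM κ) with hd
  have hdc : ∀ κ, Continuous (d κ) := fun κ =>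
    (hv.continuous_fderiv_apply one_ne_zero).comp (continuous_id.prodMk continuous_const)
  have hds : ∀ κ, HasCompactSupport (d κ) := fun κ => hvs.fderiv_apply (𝕜 := ℝ) (bM κ)
  -- the vector of partial derivatives, for uniform bounds over `κ`
  set D : Matrix (Fin N) (Fin N) ℂ → (CoordIdx N → ℝ) := fun y κ => d κ y with hD
  have hDc : Continuous D := continuous_pi fun κ => hdc κ
  have hDs : HasCompactSupport D := by
    refine HasCompactSupport.intro (K := closedBall (0 : Matrix (Fin N) (Fin N) ℂ) r₂) (isCompact_closedBall _ _)
      fun y hy => ?_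
    funext κ
    have hy' : r₂ < ‖y‖ := by rwa [mem_closedBall_zero_iff, not_le] at hy
    have hzero : v =ᶠ[𝓝 y] fun _ => 0 := by
      have hopen : IsOpen {z : Matrix (Fin N) (Fin N) ℂ | r₂ < ‖z‖} := isOpen_lt continuous_const continuous_norm
      filter_upwards [hopen.mem_nhds hy'] with z hz using hvr z hz
    show fderiv ℝ v y (bM κ) = 0
    rw [hzero.fderiv_eq]
    simp
  -- bounds
  obtain ⟨M₀, hM₀⟩ := hvc.bounded_above_of_compact_support hvs
  obtain ⟨M₁, hM₁⟩ := hDc.bounded_above_of_compact_support hDs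
  have hM₀' : 0 ≤ M₀ := (norm_nonneg _).trans (hM₀ 0)
  have hM₁' : 0 ≤ M₁ := (norm_nonneg _).trans (hM₁ 0)
  have hM₁κ : ∀ κ y, |d κ y| ≤ M₁ := fun κ y => by
    have h := (norm_le_pi_norm (D y) κ).trans (hM₁ y)
    rwa [Real.norm_eq_abs] at h
  -- uniform continuity
  have huv : UniformContinuous v := hvs.uniformContinuous_of_continuous hvc
  have huD : UniformContinuous D := hDs.uniformContinuous_of_continuous hDc
  set a : ℝ := ε / 3 with ha
  set a' : ℝ := ε / (3 * (C + 1)) with ha'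
  have ha0 : 0 < a := by positivity
  have ha'0 : 0 < a' := by positivity
  obtain ⟨δ₀, hδ₀, hδ₀v⟩ := Metric.uniformContinuous_iff.1 huv a ha0
  obtain ⟨δ₁, hδ₁, hδ₁D⟩ := Metric.uniformContinuous_iff.1 huD a' ha'0
  set η : ℝ := min δ₀ δ₁ / 2 with hη
  have hη0 : 0 < η := by positivity
  have hηδ₀ : η < δ₀ := by have := min_le_left δ₀ δ₁; rw [hη]; linarith
  have hηδ₁ : η < δ₁ := by have := min_le_right δ₀ δ₁; rw [hη]; linarith
  have hmod_v : ∀ x z : Matrix (Fin N) (Fin N) ℂ, ‖z‖ ≤ η → |v (x - z) - v x| ≤ a := by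
    intro x z hz
    have h := hδ₀v (a := x - z) (b := x) (by rw [dist_eq_norm, sub_sub_cancel_left, norm_neg]; linarith)
    rw [Real.dist_eq] at h
    exact h.le
  have hmod_d : ∀ (κ) (x z : Matrix (Fin N) (Fin N) ℂ), ‖z‖ ≤ η → |d κ (x - z) - d κ x| ≤ a' := by
    intro κ x z hz
    have h := hδ₁D (a := x - z) (b := x) (by rw [dist_eq_norm, sub_sub_cancel_left, norm_neg]; linarith)
    have h2 : dist (D (x - z) κ) (D x κ) ≤ dist (D (x - z)) (D x) := dist_le_pi_dist _ _ κ
    rw [Real.dist_eq] at h2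
    exact h2.trans h.le
  -- geometry: `SU(N) ⊆ ball 0 r₁`, `ρ = r₁ + r₂ < R`
  set r₁ : ℝ := |C₀| + 1 with hr₁
  have hgr₁ : ∀ g : SUN N, ‖(g : Matrix (Fin N) (Fin N) ℂ)‖ < r₁ := fun g => by
    have h := hC₀ g (mem_univ _)
    rw [norm_norm] at h
    rw [hr₁]; linarith [le_abs_self C₀]
  set ρ : ℝ := r₁ + r₂ with hρ
  set R : ℝ := ρ + 1 with hR
  have hρ0 : 0 < ρ := by rw [hρ, hr₁]; positivity
  have hρR : ρ < R := by rw [hR]; linarith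
  have hηR : min η ρ < R := lt_of_le_of_lt (min_le_right _ _) hρR
  set η' : ℝ := min η ρ with hη'
  have hη'0 : 0 < η' := lt_min hη0 hρ0
  have hη'η : η' ≤ η := min_le_left _ _
  set s' : ℝ := η' / 2 with hs'
  have hs'0 : 0 < s' := by positivity
  have hs'η : s' ≤ η' := by rw [hs']; linarith
  have hs'ρ : s' ≤ ρ := by linarith [min_le_right η ρ]
  have hs'R : s' < R := by linarith
  -- the geometric tail constant
  set θ : ℝ := (R ^ 2 - η' ^ 2) / (R ^ 2 - s' ^ 2) with hθ
  have hθ0 : 0 ≤ θ := by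
    rw [hθ]; refine div_nonneg ?_ ?_ <;> nlinarith [min_le_right η ρ]
  have hθ1 : θ < 1 := by
    rw [hθ, div_lt_one (by nlinarith)]
    have : s' < η' := by rw [hs']; linarith
    nlinarith
  set Cμ : ℝ := μ.real (closedBall (0 : Matrix (Fin N) (Fin N) ℂ) ρ) / μ.real (closedBall (0 : Matrix (Fin N) (Fin N) ℂ) s')
    with hCμ
  have hCμ0 : 0 ≤ Cμ := div_nonneg measureReal_nonneg measureReal_nonneg
  -- choose `k`
  obtain ⟨k, hk⟩ := exists_pow_lt_of_lt_one
    (show 0 < ε / 3 / ((Cμ + 1) * (2 * M₀ + 2 * C * M₁ + 1)) by positivity) hθ1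
  -- the normalised Landau kernel
  set Z : ℝ := ∫ z in closedBall (0 : Matrix (Fin N) (Fin N) ℂ) ρ, (R ^ 2 - ‖z‖ ^ 2) ^ k ∂μ with hZ
  have hZ0 : 0 < Z := landau_mass_pos (μ := μ) hρ0 hρR k
  set K : Matrix (Fin N) (Fin N) ℂ → ℝ := fun z => Z⁻¹ * (R ^ 2 - ‖z‖ ^ 2) ^ k with hK
  have hKc : Continuous K := continuous_const.mul ((continuous_const.sub (continuous_norm.pow 2)).pow k)
  have hK0 : ∀ z ∈ closedBall (0 : Matrix (Fin N) (Fin N) ℂ) ρ, 0 ≤ K z := fun z hz =>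
    mul_nonneg (inv_nonneg.2 hZ0.le) (landau_nonneg hρR.le hρ0.le k hz)
  have hK1 : ∫ z in closedBall (0 : Matrix (Fin N) (Fin N) ℂ) ρ, K z ∂μ = 1 := by
    simp only [hK]
    rw [integral_const_mul, ← hZ, inv_mul_cancel₀ hZ0.ne']
  have hKtail : ∫ z in closedBall (0 : Matrix (Fin N) (Fin N) ℂ) ρ \ closedBall 0 η, K z ∂μ ≤ Cμ * θ ^ k := by
    have hsub : closedBall (0 : Matrix (Fin N) (Fin N) ℂ) ρ \ closedBall 0 η ⊆ closedBall 0 ρ \ closedBall 0 η' :=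
      fun z hz => ⟨hz.1, fun h => hz.2 (closedBall_subset_closedBall hη'η h)⟩
    have hcont : Continuous fun z : Matrix (Fin N) (Fin N) ℂ => (R ^ 2 - ‖z‖ ^ 2) ^ k :=
      (continuous_const.sub (continuous_norm.pow 2)).pow k
    have hKi : IntegrableOn (fun z : Matrix (Fin N) (Fin N) ℂ => (R ^ 2 - ‖z‖ ^ 2) ^ k) (closedBall 0 ρ) μ :=
      hcont.continuousOn.integrableOn_compact (isCompact_closedBall _ _)
    have h1 : ∫ z in closedBall (0 : Matrix (Fin N) (Fin N) ℂ) ρ \ closedBall 0 η, (R ^ 2 - ‖z‖ ^ 2) ^ k ∂μ ≤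
        ∫ z in closedBall (0 : Matrix (Fin N) (Fin N) ℂ) ρ \ closedBall 0 η', (R ^ 2 - ‖z‖ ^ 2) ^ k ∂μ :=
      setIntegral_mono_set (hKi.mono_set fun z hz => hz.1)
        ((ae_restrict_iff' (measurableSet_closedBall.diff measurableSet_closedBall)).2
          (ae_of_all _ fun z hz => landau_nonneg hρR.le hρ0.le k hz.1))
        (Eventually.of_forall hsub)
    have h2 : (∫ z in closedBall (0 : Matrix (Fin N) (Fin N) ℂ) ρ \ closedBall 0 η', (R ^ 2 - ‖z‖ ^ 2) ^ k ∂μ) / Z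
        ≤ Cμ * θ ^ k := by
      have h := landau_tail_div_le (μ := μ) hs'0 hs'η hs'ρ hηR hρR k
      rw [← hZ] at h
      exact h
    have e1 : ∫ z in closedBall (0 : Matrix (Fin N) (Fin N) ℂ) ρ \ closedBall 0 η, K z ∂μ =
        Z⁻¹ * ∫ z in closedBall (0 : Matrix (Fin N) (Fin N) ℂ) ρ \ closedBall 0 η, (R ^ 2 - ‖z‖ ^ 2) ^ k ∂μ := by
      simp only [hK]
      exact integral_const_mul _ _
    rw [e1]
    calc Z⁻¹ * ∫ z in closedBall (0 : Matrix (Fin N) (Fin N) ℂ) ρ \ closedBall 0 η, (R ^ 2 - ‖z‖ ^ 2) ^ k ∂μ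
        ≤ Z⁻¹ * ∫ z in closedBall (0 : Matrix (Fin N) (Fin N) ℂ) ρ \ closedBall 0 η', (R ^ 2 - ‖z‖ ^ 2) ^ k ∂μ :=
          mul_le_mul_of_nonneg_left h1 (inv_nonneg.2 hZ0.le)
      _ = (∫ z in closedBall (0 : Matrix (Fin N) (Fin N) ℂ) ρ \ closedBall 0 η', (R ^ 2 - ‖z‖ ^ 2) ^ k ∂μ) / Z := by
          rw [inv_mul_eq_div]
      _ ≤ Cμ * θ ^ k := h2
  -- the polynomial
  obtain ⟨P, hP⟩ : ∃ P : Matrix (Fin N) (Fin N) ℂ → ℝ, P = fun x => ∫ y, v y * K (x - y) ∂μ := ⟨_, rfl⟩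
  have hPmem : P ∈ polySpace N (2 * k) := by
    rw [hP]
    exact integral_mul_landau_mem_polySpace μ hvc hvs R Z⁻¹ k
  have hPs : ContDiff ℝ ∞ P := contDiff_of_mem_polySpace hPmem
  refine ⟨2 * k, P, hPmem, ?_, ?_⟩
  · -- values
    intro g hgm
    have hg : ‖g‖ < r₁ := hgr₁ ⟨g, hgm⟩
    have hval : P g = ∫ z in closedBall (0 : Matrix (Fin N) (Fin N) ℂ) ρ, K z * v (g - z) ∂μ := by
      rw [hP]
      exact integral_mul_kernel_eq_setIntegral μ (le_refl ρ) hvr hg.le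
    rw [hval]
    have h := abs_setIntegral_mul_sub_le (μ := μ) (isCompact_closedBall _ _) measurableSet_closedBall
      hKc.continuousOn hK0 hK1 hvc g ha0.le hM₀' (hmod_v _)
      (fun y => by have := hM₀ y; rwa [Real.norm_eq_abs] at this) hKtail
    exact h.trans (landau_budget_value hε hM₀' hM₁' hC0 hCμ0 (pow_nonneg hθ0 k) hk)
  · -- derivatives
    intro g hgm α
    have hg : ‖g‖ < r₁ := hgr₁ ⟨g, hgm⟩
    have hCg : ∑ κ : CoordIdx N, |coordFn κ (g * frame α)| ≤ C := hC ⟨g, hgm⟩ α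
    have hPd : DifferentiableAt ℝ P g := (hPs.differentiable (by simp)).differentiableAt
    have hder : matD (frame α) P g = ∫ z in closedBall (0 : Matrix (Fin N) (Fin N) ℂ) ρ,
        K z * fderiv ℝ v (g - z) (g * frame α) ∂μ := by
      subst hP
      exact matD_integral_mul_kernel μ hv hvs hKc (le_refl ρ) hvr hg hPd (frame α)
    -- expand `Dv(y)[g Y_α]` over the basis
    have hexp : ∀ y : Matrix (Fin N) (Fin N) ℂ, fderiv ℝ v y (g * frame α) =
        ∑ κ : CoordIdx N, coordFn κ (g * frame α) * d κ y := fun y =>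
      clm_apply_eq_sum_coordFn _ _
    have hKi : IntegrableOn K (closedBall (0 : Matrix (Fin N) (Fin N) ℂ) ρ) μ :=
      hKc.continuousOn.integrableOn_compact (isCompact_closedBall _ _)
    have hint : ∀ κ, IntegrableOn (fun z => K z * d κ (g - z))
        (closedBall (0 : Matrix (Fin N) (Fin N) ℂ) ρ) μ := fun κ =>
      (hKc.mul ((hdc κ).comp (continuous_const.sub continuous_id))).continuousOn.integrableOn_compact
        (isCompact_closedBall _ _)
    have hmv : matD (frame α) v g = ∑ κ : CoordIdx N, coordFn κ (g * frame α) * d κ g := by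
      rw [matD_apply]
      exact hexp g
    have hintκ : ∀ κ, IntegrableOn (fun z => K z * (coordFn κ (g * frame α) * d κ (g - z)))
        (closedBall (0 : Matrix (Fin N) (Fin N) ℂ) ρ) μ := fun κ =>
      (hKc.mul (continuous_const.mul ((hdc κ).comp (continuous_const.sub continuous_id)))).continuousOn.integrableOn_compact
        (isCompact_closedBall _ _)
    have e0 : ∫ z in closedBall (0 : Matrix (Fin N) (Fin N) ℂ) ρ, K z * fderiv ℝ v (g - z) (g * frame α) ∂μ =
        ∑ κ : CoordIdx N, coordFn κ (g * frame α) *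
          ∫ z in closedBall (0 : Matrix (Fin N) (Fin N) ℂ) ρ, K z * d κ (g - z) ∂μ := by
      simp_rw [hexp, Finset.mul_sum]
      rw [integral_finsetSum _ fun κ _ => hintκ κ]
      refine sum_congr rfl fun κ _ => ?_
      rw [← integral_const_mul]
      refine integral_congr_ae (ae_of_all _ fun z => ?_)
      dsimp only
      ring
    have hder2 : matD (frame α) P g - matD (frame α) v g =
        ∑ κ : CoordIdx N, coordFn κ (g * frame α) *
          (∫ z in closedBall (0 : Matrix (Fin N) (Fin N) ℂ) ρ, K z * d κ (g - z) ∂μ - d κ g) := by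
      rw [hder, e0, hmv, ← Finset.sum_sub_distrib]
      exact sum_congr rfl fun κ _ => by ring
    rw [hder2]
    have hterm : ∀ κ, |∫ z in closedBall (0 : Matrix (Fin N) (Fin N) ℂ) ρ,
        K z * d κ (g - z) ∂μ - d κ g| ≤ a' + 2 * M₁ * (Cμ * θ ^ k) := fun κ =>
      abs_setIntegral_mul_sub_le (μ := μ) (isCompact_closedBall _ _) measurableSet_closedBall hKc.continuousOn hK0 hK1
        (hdc κ) g ha'0.le hM₁' (hmod_d κ _) (hM₁κ κ) hKtail
    calc |∑ κ : CoordIdx N, coordFn κ (g * frame α) *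
          (∫ z in closedBall (0 : Matrix (Fin N) (Fin N) ℂ) ρ, K z * d κ (g - z) ∂μ - d κ g)|
        ≤ ∑ κ : CoordIdx N, |coordFn κ (g * frame α)| * (a' + 2 * M₁ * (Cμ * θ ^ k)) := by
          refine (abs_sum_le_sum_abs _ _).trans (sum_le_sum fun κ _ => ?_)
          rw [abs_mul]
          exact mul_le_mul_of_nonneg_left (hterm κ) (abs_nonneg _)
      _ ≤ C * (a' + 2 * M₁ * (Cμ * θ ^ k)) := by
          rw [← Finset.sum_mul]
          exact mul_le_mul_of_nonneg_right hCg
            (add_nonneg ha'0.le (mul_nonneg (mul_nonneg (by norm_num) hM₁') (mul_nonneg hCμ0 (pow_nonneg hθ0 k))))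
      _ ≤ ε := landau_budget_deriv hε hM₀' hM₁' hC0 hCμ0 (pow_nonneg hθ0 k) hk

/-- ★ **Weierstrass approximation with derivatives on `SU(N)`** (Landau–Lang), measure-free form: for a `C¹` function
`v` on `M_N(ℂ)` vanishing outside the ball of radius `r₂` and `ε > 0`, there is a polynomial `P ∈ 𝒫_n` with `|P − v| ≤ ε`
and `|D_α P − D_α v| ≤ ε` on `SU(N)` for every frame direction `α` (apply `exists_poly_approx_C1_measure` to Lebesgue
measure on `M_N(ℂ) ≅ ℝ^{2N²}`). [cite: Lang1999MathTalks, Dirac sequences and the Weierstrass approximation theorem pp. 36–38] -/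
theorem exists_poly_approx_C1 {v : Matrix (Fin N) (Fin N) ℂ → ℝ} (hv : ContDiff ℝ 1 v) {r₂ : ℝ} (hr₂ : 0 < r₂)
    (hvr : ∀ y, r₂ < ‖y‖ → v y = 0) {ε : ℝ} (hε : 0 < ε) :
    ∃ n : ℕ, ∃ P ∈ polySpace N n,
      (∀ x : Matrix (Fin N) (Fin N) ℂ, x ∈ Matrix.specialUnitaryGroup (Fin N) ℂ → |P x - v x| ≤ ε) ∧
      ∀ x : Matrix (Fin N) (Fin N) ℂ, x ∈ Matrix.specialUnitaryGroup (Fin N) ℂ →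
        ∀ α : FrameIdx N, |matD (frame α) P x - matD (frame α) v x| ≤ ε := by
  -- Lebesgue measure for the Frobenius-norm (= product) topology, and product-topology copies of its instances
  letI tE : TopologicalSpace (Matrix (Fin N) (Fin N) ℂ) := matTop N
  borelize (Matrix (Fin N) (Fin N) ℂ)
  haveI hB2 : @BorelSpace (Matrix (Fin N) (Fin N) ℂ) instTopologicalSpaceMatrix _ :=
    ‹BorelSpace (Matrix (Fin N) (Fin N) ℂ)›
  haveI hF2 : @IsFiniteMeasureOnCompacts (Matrix (Fin N) (Fin N) ℂ) _ instTopologicalSpaceMatrix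
      (MeasureTheory.Measure.addHaar : Measure (Matrix (Fin N) (Fin N) ℂ)) :=
    (inferInstance : IsFiniteMeasureOnCompacts (MeasureTheory.Measure.addHaar : Measure (Matrix (Fin N) (Fin N) ℂ)))
  haveI hO2 : @Measure.IsOpenPosMeasure (Matrix (Fin N) (Fin N) ℂ) instTopologicalSpaceMatrix _
      (MeasureTheory.Measure.addHaar : Measure (Matrix (Fin N) (Fin N) ℂ)) :=
    (inferInstance : (MeasureTheory.Measure.addHaar : Measure (Matrix (Fin N) (Fin N) ℂ)).IsOpenPosMeasure)
  exact exists_poly_approx_C1_measure (MeasureTheory.Measure.addHaar : Measure (Matrix (Fin N) (Fin N) ℂ)) hv hr₂ hvr hε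

end SUNBakryEmery

end Literature.MathematicalPhysics.QuantumFieldTheory
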